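import Summits.QuantumFields.BalabanUV.T4Continuum.Support.NE7TowerGapFromC1
import Summits.QuantumFields.BalabanUV.T4Continuum.Support.NE7EtaBackgroundTensionClass
import HarnessLib

/-!
# NE7TensionEnergyDocked — THE ENERGY ROAD DOCKED INTO (H∃)ᴱ: the per-level tension-energy bound of `NE7TowerGapFromC1` in the currency
# `g′·N^d·(L^k)^d∕(L^k)⁶` of `NE7EtaBackgroundTensionClass.hminE_of_tension_apriori`, the two lowest levels bounded trivially, and (H∃)ᴱ
# DERIVED from INTERIORITY (8) + explicit smallness of `ε` along the tower

Cell `pub-balaban`, rung (B)+1 sub-cell t4, lineage `b2b-balaban-t4-ne7-p1`, generation 63 (CRUX PROVER NE7 #1, ruling e34b3e0c (2)); hunt (h7)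
«ENERGY ROAD», step (h7-vii) DOCKING.  §1 **`sum_nhsNormSq_tension_le_trivial`** — for unitary `V` and `‖B‖ ≤ b` the tension energy over
`periodBox P` is `≤ P^d·d·(2d·b)²` (each `cDstar` copy is an isometric transport minus the identity);  §2 `gprime_arith` (real-variable arithmetic) and **`tension_energy_le_gprime`** — the END
`NE7TowerGapFromC1.tension_energy_le_of_C1_tower` at an interior `(j+2)`-level constrained minimiser in the currency `g′·N^d·(L^{j+2})^d∕(L^{j+2})⁶`,
`g′ = 624·d³ε²(1+(d+1)ε)² + 6768·#Plane²·d·card n·ε⁴` (arithmetic only: `a < ε(L^{j+2})^{−2}`, `λ′ ≥ M^d·M²∕3`, `Λ′² ≤ 3λ′`, `δ² ≤ λ′∕64`, `M ≥ 1`);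
§3 **`tension_energy_le_low`** — levels `k ≤ 1` from §1 and class membership: `≤ 16d³ε²L²·N^d(L^k)^d∕(L^k)⁶`;
§4 **`hminE_of_interior`** — `hminE_of_tension_apriori` FED: in the existence regime (`L ≥ 2`, `0 ≤ ε ≤ 1∕50`, `16C₀ε ≤ 3`, `1024(d+1)(d+4)L²ε ≤ 1`,
admissible sets non-empty), under the three explicit smallness families of the class radius `x_j = ε(L^{j+2})^{−2}` (`LevelSmall d L (j+1) x_j`,
`K·radSum d L (j+1) x_j ≤ ρ∕2`, `8√(3 card n)(C₁(j) + 2K·radSum d L (j+1) x_j·√(L^d∕L²)) ≤ 1`, all `j`) and INTERIORITY (8) (every `(j+2)`-level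
constrained minimiser over `dom` is `SmallField U a` for some `0 ≤ a < x_j` — B11 Theorem 1 type, NOT in the tree: a HYPOTHESIS), (H∃)ᴱ holds:
`∀ V ∈ dom, ∀ k, ∃ U, IsMinimiser … k V U ∧ Regular d L N ε (card n·g″ + 220·card n·d³ε³) k U`, `g″ = g′ + 16d³ε²L²`.
HONEST FRAMING (page 1): re-assembly on a FIXED FINITE torus, rung (B)+1; (H∃)ᴱ CONDITIONAL on (8) and on explicit smallness of ε along the tower;
NE7, NE3 NOT PRINTED in [Balaban1984PropagatorsI]–[Balaban1989LargeFieldII] and NOT PROVED; continuum YM on T⁴ ⇐ BetaPertH ∧ nine spine estimates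
(0/9 proved); BetaPertH ⇐ (D1) ∧ (D4) ∧ CAP+tail; G-an2-4 gates asym, D1 and NE2/3/4; NOT infinite volume, NOT mass gap, NOT Clay.  0 def, 0 sorry.
-/

set_option autoImplicit false

open scoped BigOperators InnerProductSpace Matrix Matrix.Norms.L2Operator
open Finset

namespace Summit.QuantumFields.BalabanUV.T4Continuum.NE7TensionEnergyDocked

open Literature.MathematicalPhysics.QuantumFieldTheory.Balaban1983to89
open B7Prop1Explicit B7Prop2Explicit MatrixNorms UnitaryModel
open T4AveragingDeficitWall (IsUnitaryCfg SmallField Ad flux)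
open T4AveragingDeficitWallBoundary (periodBox IsPeriodicCfg card_periodBox)
open AveragingDeficitTransport (norm_Ad_of_unitary)
open AveragingDeficitMultiLevelPrep (LevelSmall)
open ReplicationRightInverseBound (radSum radSum_nonneg)
open MinimalActionSandwich (IsMinimiser admissible)
open MinimalActionRate (Regular sfClass)
open NE3CovariantCalculus (cDstar)
open NE3HilbertSchmidtTorus
open NE3CovariantLineSumsL2Tower (rho rho_nonneg)
open NE3ExactLineSumsTower (DSum DSum_nonneg)
open NE7FluxGradientFromTension (norm_fluxForm_le)
open NE7TowerGapFromC1 (tension_energy_le_of_C1_tower gram_floor_ge eight_mul_delta_le_sqrt)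
open NE7EtaBackgroundTensionClass (hminE_of_tension_apriori)

noncomputable section

variable {d : ℕ} {n : Type*} [Fintype n] [DecidableEq n]

/-! ## §1 The trivial tension bound -/

/-- **TRIVIAL TENSION BOUND.**  For unitary `V` and a two-index field with `‖B x μ ν‖ ≤ b`:
`Σ_{x∈periodBox P} Σ_ν nhsNormSq (Σ_μ cDstar V μ B_{·μν}(x)) ≤ P^d·d·(2d·b)²`. [folklore] -/
theorem sum_nhsNormSq_tension_le_trivial {V : Site d → Fin d → (Matrix n n ℂ)ˣ} (hV : IsUnitaryCfg V)
    {B : Site d → Fin d → Fin d → Matrix n n ℂ} {b : ℝ} (hB : ∀ (x : Site d) (μ ν : Fin d), ‖B x μ ν‖ ≤ b) (P : ℕ) :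
    ∑ x ∈ periodBox (d := d) P, ∑ ν : Fin d, nhsNormSq (∑ μ : Fin d, cDstar V μ (fun y => B y μ ν) x)
      ≤ (P : ℝ) ^ d * d * (2 * d * b) ^ 2 := by
  -- pointwise: every `cDstar` copy is at most `2b`
  have hpt : ∀ (x : Site d) (ν : Fin d), nhsNormSq (∑ μ : Fin d, cDstar V μ (fun y => B y μ ν) x) ≤ (2 * d * b) ^ 2 := by
    intro x ν
    have h1 : ‖∑ μ : Fin d, cDstar V μ (fun y => B y μ ν) x‖ ≤ 2 * d * b := by
      calc ‖∑ μ : Fin d, cDstar V μ (fun y => B y μ ν) x‖ ≤ ∑ μ : Fin d, ‖cDstar V μ (fun y => B y μ ν) x‖ := norm_sum_le _ _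
        _ ≤ ∑ _μ : Fin d, 2 * b := by
            refine Finset.sum_le_sum fun μ _ => ?_
            unfold cDstar
            calc ‖Ad (V (x - e μ) μ)⁻¹ (B (x - e μ) μ ν) - B x μ ν‖
                ≤ ‖Ad (V (x - e μ) μ)⁻¹ (B (x - e μ) μ ν)‖ + ‖B x μ ν‖ := norm_sub_le _ _
              _ ≤ b + b := by
                  rw [norm_Ad_of_unitary ((unitaryUnits (Matrix n n ℂ)).inv_mem (hV _ _))]
                  exact add_le_add (hB _ _ _) (hB _ _ _)
              _ = 2 * b := by ring
        _ = 2 * d * b := by rw [Finset.sum_const, Finset.card_univ, Fintype.card_fin, nsmul_eq_mul]; ring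
    calc nhsNormSq (∑ μ : Fin d, cDstar V μ (fun y => B y μ ν) x)
        ≤ ‖∑ μ : Fin d, cDstar V μ (fun y => B y μ ν) x‖ ^ 2 := nhsNormSq_le_opNorm_sq _
      _ ≤ (2 * d * b) ^ 2 := pow_le_pow_left₀ (norm_nonneg _) h1 2
  calc ∑ x ∈ periodBox (d := d) P, ∑ ν : Fin d, nhsNormSq (∑ μ : Fin d, cDstar V μ (fun y => B y μ ν) x)
      ≤ ∑ x ∈ periodBox (d := d) P, ∑ _ν : Fin d, (2 * d * b) ^ 2 :=
        Finset.sum_le_sum fun x _ => Finset.sum_le_sum fun ν _ => hpt x ν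
    _ = (P : ℝ) ^ d * d * (2 * d * b) ^ 2 := by
        simp only [Finset.sum_const, Finset.card_univ, Fintype.card_fin, card_periodBox, nsmul_eq_mul]
        push_cast; ring

/-! ## §2 The interior `(j+2)`-level bound in the `g′` currency -/

/-- **ARITHMETIC OF THE END** (real variables; `M ≥ 1` the block size, `Nd = N^d`, `X1^d = M^d·Nd`, `0 ≤ a ≤ ε∕M²`, `8δ ≤ √λ′`):
the END's right-hand side is at most `(624·d³ε²(1+(d+1)ε)² + 6768·P²·d·cn·ε⁴)·(Nd·M^d∕M⁶)`. [folklore] -/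
theorem gprime_arith (d : ℕ) {M Nd a ε cn P δ X1 : ℝ} (hM1 : 1 ≤ M) (hNd : 0 ≤ Nd) (ha0 : 0 ≤ a) (haM : a ≤ ε / M ^ 2)
    (hcn : 0 ≤ cn) (hδ0 : 0 ≤ δ) (h8 : 8 * δ ≤ Real.sqrt (M ^ (d - 1) * (M * (M ^ 2 + 2) / 3)))
    (hX0 : 0 ≤ X1) (hX : X1 ^ d = M ^ d * Nd) :
    13 * (Nd * d * (2 * d * M ^ d * (2 * a) * (1 + ((d : ℝ) + 1) * (M - 1) * M * a)) ^ 2) / (M ^ (d - 1) * (M * (M ^ 2 + 2) / 3))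
        + (7 * (Real.sqrt (M ^ (d - 1) * M ^ 3) + δ) ^ 2 / (M ^ (d - 1) * (M * (M ^ 2 + 2) / 3)) + 4)
          * (12 * P * a ^ 2 * Real.sqrt (d * X1 ^ d * cn)) ^ 2
      ≤ (624 * (d : ℝ) ^ 3 * ε ^ 2 * (1 + ((d : ℝ) + 1) * ε) ^ 2 + 6768 * P ^ 2 * d * cn * ε ^ 4) * (Nd * M ^ d / M ^ 6) := by
  have hM0 : 0 < M := lt_of_lt_of_le one_pos hM1
  set lam : ℝ := M ^ (d - 1) * (M * (M ^ 2 + 2) / 3) with hlam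
  set Lam : ℝ := Real.sqrt (M ^ (d - 1) * M ^ 3) with hLam
  set A : ℝ := 2 * d * M ^ d * (2 * a) * (1 + ((d : ℝ) + 1) * (M - 1) * M * a) with hA
  set θ : ℝ := 12 * P * a ^ 2 * Real.sqrt (d * X1 ^ d * cn) with hθ
  clear_value lam Lam A θ
  have hlam_ge : M ^ d * M ^ 2 / 3 ≤ lam := by rw [hlam]; exact gram_floor_ge hM1 d
  have hlam0 : 0 < lam := lt_of_lt_of_le (by positivity) hlam_ge
  have hε0 : 0 ≤ ε := by
    have h1 := le_trans ha0 haM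
    rwa [le_div_iff₀ (by positivity), zero_mul] at h1
  have hMa0 : 0 ≤ (M - 1) * M * a := mul_nonneg (mul_nonneg (by linarith) hM0.le) ha0
  have hMa : (M - 1) * M * a ≤ ε := by
    calc (M - 1) * M * a ≤ M * M * a := by gcongr; linarith
      _ = M ^ 2 * a := by ring
      _ ≤ M ^ 2 * (ε / M ^ 2) := by gcongr
      _ = ε := by field_simp
  -- the first term
  have hA0 : 0 ≤ A := by
    rw [hA]
    refine mul_nonneg (by positivity) (add_nonneg zero_le_one ?_)
    exact mul_nonneg (mul_nonneg (mul_nonneg (by positivity) (by linarith)) hM0.le) ha0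
  have hAle : A ≤ 4 * d * M ^ d * (ε / M ^ 2) * (1 + ((d : ℝ) + 1) * ε) := by
    have e : A = 4 * d * M ^ d * a * (1 + ((d : ℝ) + 1) * ((M - 1) * M * a)) := by rw [hA]; ring
    rw [e]
    exact mul_le_mul (by gcongr) (by gcongr) (add_nonneg zero_le_one (mul_nonneg (by positivity) hMa0)) (by positivity)
  have hA2 : A ^ 2 ≤ (4 * d * M ^ d * (ε / M ^ 2) * (1 + ((d : ℝ) + 1) * ε)) ^ 2 := pow_le_pow_left₀ hA0 hAle 2
  have hT1 : 13 * (Nd * d * A ^ 2) / lam ≤ 624 * (d : ℝ) ^ 3 * ε ^ 2 * (1 + ((d : ℝ) + 1) * ε) ^ 2 * (Nd * M ^ d / M ^ 6) := by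
    calc 13 * (Nd * d * A ^ 2) / lam
        ≤ 13 * (Nd * d * (4 * d * M ^ d * (ε / M ^ 2) * (1 + ((d : ℝ) + 1) * ε)) ^ 2) / lam :=
          div_le_div_of_nonneg_right (by gcongr) hlam0.le
      _ ≤ 13 * (Nd * d * (4 * d * M ^ d * (ε / M ^ 2) * (1 + ((d : ℝ) + 1) * ε)) ^ 2) / (M ^ d * M ^ 2 / 3) :=
          div_le_div_of_nonneg_left (by positivity) (by positivity) hlam_ge
      _ = _ := by field_simp; ring
  -- the coefficient of the second term
  have hΛ2 : Lam ^ 2 ≤ 3 * lam := by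
    rw [hLam, Real.sq_sqrt (by positivity), hlam]
    have h3 : M ^ 3 ≤ M * (M ^ 2 + 2) := by
      have h2M : 0 ≤ 2 * M := by positivity
      calc M ^ 3 = M * (M ^ 2 + 2) - 2 * M := by ring
        _ ≤ M * (M ^ 2 + 2) := by linarith
    have h0 : 0 ≤ M ^ (d - 1) := by positivity
    have h4 := mul_le_mul_of_nonneg_left h3 h0
    calc M ^ (d - 1) * M ^ 3 ≤ M ^ (d - 1) * (M * (M ^ 2 + 2)) := h4
      _ = 3 * (M ^ (d - 1) * (M * (M ^ 2 + 2) / 3)) := by ring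
  have hδ2 : δ ^ 2 ≤ lam / 64 := by
    have h1 := pow_le_pow_left₀ (by positivity) h8 2
    rw [mul_pow, Real.sq_sqrt hlam0.le] at h1
    linarith
  have hsq : (Lam + δ) ^ 2 ≤ 2 * Lam ^ 2 + 2 * δ ^ 2 := by
    have h0 := sq_nonneg (Lam - δ)
    calc (Lam + δ) ^ 2 = 2 * Lam ^ 2 + 2 * δ ^ 2 - (Lam - δ) ^ 2 := by ring
      _ ≤ 2 * Lam ^ 2 + 2 * δ ^ 2 := by linarith
  have hcoef : 7 * (Lam + δ) ^ 2 / lam + 4 ≤ 47 := by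
    rw [div_add' _ _ _ hlam0.ne', div_le_iff₀ hlam0]
    linarith [hsq, hΛ2, hδ2, hlam0.le]
  -- the second term
  have hθ2 : θ ^ 2 ≤ 144 * P ^ 2 * ε ^ 4 * d * cn * (Nd * M ^ d / M ^ 8) := by
    have hsq : θ ^ 2 = 144 * P ^ 2 * a ^ 4 * (d * (M ^ d * Nd) * cn) := by
      rw [hθ]; simp only [mul_pow]; rw [Real.sq_sqrt (by positivity), hX]; ring
    rw [hsq]
    have ha4' : a ^ 4 ≤ (ε / M ^ 2) ^ 4 := pow_le_pow_left₀ ha0 haM 4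
    calc 144 * P ^ 2 * a ^ 4 * (d * (M ^ d * Nd) * cn) ≤ 144 * P ^ 2 * (ε / M ^ 2) ^ 4 * (d * (M ^ d * Nd) * cn) := by gcongr
      _ = _ := by field_simp
  have hM68 : Nd * M ^ d / M ^ 8 ≤ Nd * M ^ d / M ^ 6 :=
    div_le_div_of_nonneg_left (by positivity) (by positivity) (pow_le_pow_right₀ hM1 (by norm_num))
  have hT2 : (7 * (Lam + δ) ^ 2 / lam + 4) * θ ^ 2 ≤ 6768 * P ^ 2 * d * cn * ε ^ 4 * (Nd * M ^ d / M ^ 6) := by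
    calc (7 * (Lam + δ) ^ 2 / lam + 4) * θ ^ 2 ≤ 47 * θ ^ 2 := mul_le_mul_of_nonneg_right hcoef (sq_nonneg _)
      _ ≤ 47 * (144 * P ^ 2 * ε ^ 4 * d * cn * (Nd * M ^ d / M ^ 8)) := mul_le_mul_of_nonneg_left hθ2 (by norm_num)
      _ ≤ 47 * (144 * P ^ 2 * ε ^ 4 * d * cn * (Nd * M ^ d / M ^ 6)) := by gcongr
      _ = _ := by ring
  calc 13 * (Nd * d * A ^ 2) / lam + (7 * (Lam + δ) ^ 2 / lam + 4) * θ ^ 2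
      ≤ 624 * (d : ℝ) ^ 3 * ε ^ 2 * (1 + ((d : ℝ) + 1) * ε) ^ 2 * (Nd * M ^ d / M ^ 6)
          + 6768 * P ^ 2 * d * cn * ε ^ 4 * (Nd * M ^ d / M ^ 6) := add_le_add hT1 hT2
    _ = _ := by ring

/-- **THE END IN THE `g′` CURRENCY.**  Under the hypotheses of `NE7TowerGapFromC1.tension_energy_le_of_C1_tower` (interior `(j+2)`-level
constrained minimiser, `L ≥ 2`, the two smallness inequalities), the tension energy is
`≤ g′·N^d·(L^{j+2})^d∕(L^{j+2})⁶`, `g′ = 624·d³ε²(1+(d+1)ε)² + 6768·#Plane²·d·card n·ε⁴`. [folklore] -/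
theorem tension_energy_le_gprime [Nonempty n] {L N : ℕ} (hL2 : 2 ≤ L) (hN : 1 ≤ N) {ε a : ℝ} (j : ℕ)
    {V U : Site d → Fin d → (Matrix n n ℂ)ˣ} (hmin : IsMinimiser d (sfClass d L N ε) L N (j + 2) V U)
    (ha0 : 0 ≤ a) (ha4 : a ≤ 1 / 4) (haε : a < ε / ((L : ℝ) ^ (j + 2)) ^ 2) (hUa : SmallField U a)
    (hls : LevelSmall d L (j + 1) (ε / ((L : ℝ) ^ (j + 2)) ^ 2))
    (hKS : (160064 * (d : ℝ) * (d + 1) * (d + 4) * (L : ℝ) ^ 3) * radSum d L (j + 1) (ε / ((L : ℝ) ^ (j + 2)) ^ 2) ≤ rho d L / 2)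
    (hsmall : 8 * Real.sqrt (3 * Fintype.card n)
        * (2 * ((4 * d + 5) / 10 * DSum d L (j + 2) (ε / ((L : ℝ) ^ (j + 2)) ^ 2))
            + 2 * ((160064 * (d : ℝ) * (d + 1) * (d + 4) * (L : ℝ) ^ 3) * radSum d L (j + 1) (ε / ((L : ℝ) ^ (j + 2)) ^ 2))
              * Real.sqrt ((L : ℝ) ^ d / (L : ℝ) ^ 2)) ≤ 1)
    {B : Site d → Fin d → Fin d → Matrix n n ℂ} (hBF : ∀ (x : Site d) (μ ν : Fin d) (h : μ < ν), B x μ ν = flux U (x, ⟨(μ, ν), h⟩))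
    (hanti : ∀ (x : Site d) (μ ν : Fin d), B x ν μ = -B x μ ν)
    [NeZero N] [NeZero (L ^ (j + 2) * N)] :
    ∑ x ∈ periodBox (d := d) (L ^ (j + 2) * N), ∑ ν : Fin d, nhsNormSq (∑ μ : Fin d, cDstar U μ (fun y => B y μ ν) x)
      ≤ (624 * (d : ℝ) ^ 3 * ε ^ 2 * (1 + ((d : ℝ) + 1) * ε) ^ 2
          + 6768 * (Fintype.card (T4AveragingDeficitWall.Plane d) : ℝ) ^ 2 * d * Fintype.card n * ε ^ 4)
        * (N : ℝ) ^ d * ((L : ℝ) ^ (j + 2)) ^ d / ((L : ℝ) ^ (j + 2)) ^ 6 := by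
  have hL : 1 ≤ L := le_trans (by norm_num) hL2
  have h := tension_energy_le_of_C1_tower hL2 hN j hmin ha0 ha4 haε hUa hls hKS hsmall hBF hanti
  have hMR : ((L ^ (j + 2) : ℕ) : ℝ) = (L : ℝ) ^ (j + 2) := by push_cast; rfl
  have hM1 : (1 : ℝ) ≤ ((L ^ (j + 2) : ℕ) : ℝ) := by exact_mod_cast Nat.one_le_pow _ _ hL
  have hx0 : 0 ≤ ε / ((L : ℝ) ^ (j + 2)) ^ 2 := ha0.trans haε.le
  have hC0 : 0 ≤ 2 * ((4 * d + 5) / 10 * DSum d L (j + 2) (ε / ((L : ℝ) ^ (j + 2)) ^ 2)) := by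
    have := DSum_nonneg d L (j + 2) hx0; positivity
  have hE0 : 0 ≤ 2 * ((160064 * (d : ℝ) * (d + 1) * (d + 4) * (L : ℝ) ^ 3)
      * radSum d L (j + 1) (ε / ((L : ℝ) ^ (j + 2)) ^ 2)) := by
    have := radSum_nonneg (d := d) (L := L) (j + 1) hx0; positivity
  have hδ0 : 0 ≤ Real.sqrt (Fintype.card n)
      * ((2 * ((4 * d + 5) / 10 * DSum d L (j + 2) (ε / ((L : ℝ) ^ (j + 2)) ^ 2)))
          * (Real.sqrt (((L ^ (j + 2) : ℕ) : ℝ) ^ d) * ((L ^ (j + 2) : ℕ) : ℝ))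
        + ((L ^ (j + 2) : ℕ) : ℝ) ^ d
          * (2 * ((160064 * (d : ℝ) * (d + 1) * (d + 4) * (L : ℝ) ^ 3)
              * radSum d L (j + 1) (ε / ((L : ℝ) ^ (j + 2)) ^ 2)) * rho d L ^ (j + 1))) := by
    have := rho_nonneg d L; positivity
  have h8 := eight_mul_delta_le_sqrt hL d j hC0 hE0 hsmall
  have haM : a ≤ ε / ((L ^ (j + 2) : ℕ) : ℝ) ^ 2 := by rw [hMR]; exact haε.le
  have hX : (((L ^ (j + 2) * N : ℕ) : ℕ) : ℝ) ^ d = ((L ^ (j + 2) : ℕ) : ℝ) ^ d * (N : ℝ) ^ d := by push_cast; ring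
  have key := gprime_arith d (P := (Fintype.card (T4AveragingDeficitWall.Plane d) : ℝ)) (cn := (Fintype.card n : ℝ))
    hM1 (by positivity : (0 : ℝ) ≤ (N : ℝ) ^ d) ha0 haM (Nat.cast_nonneg _) hδ0 h8 (by positivity) hX
  refine (h.trans key).trans_eq ?_
  rw [hMR]; ring

/-! ## §3 The two lowest levels -/

/-- **LEVELS `k ≤ 1`.**  A `k`-level constrained minimiser over `sfClass d L N ε` (`0 ≤ ε ≤ 1∕4`, `L ≥ 1`, `k ≤ 1`) has tension energy
`≤ 16d³ε²L²·N^d·(L^k)^d∕(L^k)⁶` — the trivial bound of §1 with `‖B‖ ≤ 2ε(L^k)^{−2}` and `(L^k)² ≤ L²`. [folklore] -/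
theorem tension_energy_le_low [Nonempty n] {L N : ℕ} (hL : 1 ≤ L) {ε : ℝ} (hε0 : 0 ≤ ε) (hε : ε ≤ 1 / 4) {k : ℕ} (hk : k ≤ 1)
    {V U : Site d → Fin d → (Matrix n n ℂ)ˣ} (hmin : IsMinimiser d (sfClass d L N ε) L N k V U)
    {B : Site d → Fin d → Fin d → Matrix n n ℂ} (hBF : ∀ (x : Site d) (μ ν : Fin d) (h : μ < ν), B x μ ν = flux U (x, ⟨(μ, ν), h⟩))
    (hanti : ∀ (x : Site d) (μ ν : Fin d), B x ν μ = -B x μ ν) :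
    ∑ x ∈ periodBox (d := d) (N * L ^ k), ∑ ν : Fin d, nhsNormSq (∑ μ : Fin d, cDstar U μ (fun y => B y μ ν) x)
      ≤ 16 * (d : ℝ) ^ 3 * ε ^ 2 * (L : ℝ) ^ 2 * (N : ℝ) ^ d * ((L : ℝ) ^ k) ^ d / ((L : ℝ) ^ k) ^ 6 := by
  have hU : IsUnitaryCfg U := hmin.mem.1.1
  have hUa : SmallField U (ε / ((L : ℝ) ^ k) ^ 2) := hmin.mem.1.2.2
  have hL1 : (1 : ℝ) ≤ L := by exact_mod_cast hL
  have hQ1 : (1 : ℝ) ≤ (L : ℝ) ^ k := one_le_pow₀ hL1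
  have hQ0 : (0 : ℝ) < (L : ℝ) ^ k := lt_of_lt_of_le one_pos hQ1
  have hQL : (L : ℝ) ^ k ≤ L := by
    interval_cases k
    · simpa using hL1
    · simp
  have ha0 : 0 ≤ ε / ((L : ℝ) ^ k) ^ 2 := by positivity
  have ha2 : ε / ((L : ℝ) ^ k) ^ 2 ≤ 1 / 2 := le_trans (div_le_self hε0 (one_le_pow₀ hQ1)) (by linarith)
  have hB : ∀ (x : Site d) (μ ν : Fin d), ‖B x μ ν‖ ≤ 2 * (ε / ((L : ℝ) ^ k) ^ 2) :=
    fun x μ ν => norm_fluxForm_le ha0 ha2 hUa hBF hanti x μ ν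
  have h := sum_nhsNormSq_tension_le_trivial hU hB (N * L ^ k)
  have hcast : ((N * L ^ k : ℕ) : ℝ) ^ d = (N : ℝ) ^ d * ((L : ℝ) ^ k) ^ d := by push_cast; ring
  rw [hcast] at h
  refine h.trans ?_
  have e : (N : ℝ) ^ d * ((L : ℝ) ^ k) ^ d * d * (2 * d * (2 * (ε / ((L : ℝ) ^ k) ^ 2))) ^ 2
      = (16 * (d : ℝ) ^ 3 * ε ^ 2 * (N : ℝ) ^ d * ((L : ℝ) ^ k) ^ d / ((L : ℝ) ^ k) ^ 6) * ((L : ℝ) ^ k) ^ 2 := by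
    field_simp; ring
  rw [e]
  have hnn : 0 ≤ 16 * (d : ℝ) ^ 3 * ε ^ 2 * (N : ℝ) ^ d * ((L : ℝ) ^ k) ^ d / ((L : ℝ) ^ k) ^ 6 := by positivity
  calc (16 * (d : ℝ) ^ 3 * ε ^ 2 * (N : ℝ) ^ d * ((L : ℝ) ^ k) ^ d / ((L : ℝ) ^ k) ^ 6) * ((L : ℝ) ^ k) ^ 2
      ≤ (16 * (d : ℝ) ^ 3 * ε ^ 2 * (N : ℝ) ^ d * ((L : ℝ) ^ k) ^ d / ((L : ℝ) ^ k) ^ 6) * (L : ℝ) ^ 2 :=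
        mul_le_mul_of_nonneg_left (pow_le_pow_left₀ hQ0.le hQL 2) hnn
    _ = _ := by ring

/-! ## §4 (H∃)ᴱ from interiority (8) and explicit smallness -/

/-- **(H∃)ᴱ FROM INTERIORITY (8).**  In the existence regime of `hminE_of_tension_apriori` (`L ≥ 2`, `N ≥ 1`, `0 ≤ ε ≤ 1∕50`, `16C₀ε ≤ 3`,
`1024(d+1)(d+4)L²ε ≤ 1`, admissible sets non-empty over `dom`), assume for every `j` the three explicit smallness inequalities of the class
radius `x_j = ε(L^{j+2})^{−2}` and INTERIORITY (8): every `(j+2)`-level constrained minimiser over `dom` is `SmallField U a` for some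
`0 ≤ a < x_j` (B11 Theorem 1 type — a HYPOTHESIS, not in the tree).  THEN (H∃)ᴱ holds with
`g = card n·g″ + 220·card n·d³ε³`, `g″ = 624·d³ε²(1+(d+1)ε)² + 6768·#Plane²·d·card n·ε⁴ + 16d³ε²L²`. [folklore] -/
theorem hminE_of_interior [Nonempty n] {L N : ℕ} (hL2 : 2 ≤ L) (hN : 1 ≤ N) {ε : ℝ} (hε0 : 0 ≤ ε) (hε : ε ≤ 1 / 50)
    (hε1 : 16 * C0 d * ε ≤ 3) (hε2 : 1024 * (d + 1) * (d + 4) * (L : ℝ) ^ 2 * ε ≤ 1)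
    {dom : Set (Site d → Fin d → (Matrix n n ℂ)ˣ)}
    (hne : ∀ V ∈ dom, ∀ k : ℕ, (admissible (sfClass d L N ε) L k V).Nonempty)
    (hls : ∀ j : ℕ, LevelSmall d L (j + 1) (ε / ((L : ℝ) ^ (j + 2)) ^ 2))
    (hKS : ∀ j : ℕ, (160064 * (d : ℝ) * (d + 1) * (d + 4) * (L : ℝ) ^ 3) * radSum d L (j + 1) (ε / ((L : ℝ) ^ (j + 2)) ^ 2)
      ≤ rho d L / 2)
    (hsmall : ∀ j : ℕ, 8 * Real.sqrt (3 * Fintype.card n)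
        * (2 * ((4 * d + 5) / 10 * DSum d L (j + 2) (ε / ((L : ℝ) ^ (j + 2)) ^ 2))
            + 2 * ((160064 * (d : ℝ) * (d + 1) * (d + 4) * (L : ℝ) ^ 3) * radSum d L (j + 1) (ε / ((L : ℝ) ^ (j + 2)) ^ 2))
              * Real.sqrt ((L : ℝ) ^ d / (L : ℝ) ^ 2)) ≤ 1)
    (hint : ∀ V ∈ dom, ∀ (j : ℕ) (U : Site d → Fin d → (Matrix n n ℂ)ˣ), IsMinimiser d (sfClass d L N ε) L N (j + 2) V U →
      ∃ a : ℝ, 0 ≤ a ∧ a < ε / ((L : ℝ) ^ (j + 2)) ^ 2 ∧ SmallField U a) :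
    ∀ V ∈ dom, ∀ k : ℕ, ∃ U, IsMinimiser d (sfClass d L N ε) L N k V U ∧
      Regular d L N ε ((Fintype.card n : ℝ)
          * (624 * (d : ℝ) ^ 3 * ε ^ 2 * (1 + ((d : ℝ) + 1) * ε) ^ 2
              + 6768 * (Fintype.card (T4AveragingDeficitWall.Plane d) : ℝ) ^ 2 * d * Fintype.card n * ε ^ 4
              + 16 * (d : ℝ) ^ 3 * ε ^ 2 * (L : ℝ) ^ 2)
        + 220 * (Fintype.card n : ℝ) * (d : ℝ) ^ 3 * ε ^ 3) k U := by
  have hL : 1 ≤ L := le_trans (by norm_num) hL2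
  refine hminE_of_tension_apriori hL2 hN hε0 hε hε1 hε2 hne fun V hV k U B hmin hBF hanti => ?_
  -- common nonnegative pieces of `g″`
  have hg1 : 0 ≤ 624 * (d : ℝ) ^ 3 * ε ^ 2 * (1 + ((d : ℝ) + 1) * ε) ^ 2 := by positivity
  have hg2 : 0 ≤ 6768 * (Fintype.card (T4AveragingDeficitWall.Plane d) : ℝ) ^ 2 * d * Fintype.card n * ε ^ 4 := by positivity
  have hg3 : 0 ≤ 16 * (d : ℝ) ^ 3 * ε ^ 2 * (L : ℝ) ^ 2 := by positivity
  have hsc : 0 ≤ (N : ℝ) ^ d * ((L : ℝ) ^ k) ^ d / ((L : ℝ) ^ k) ^ 6 := by positivity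
  rcases Nat.lt_or_ge k 2 with hk | hk
  · -- the two lowest levels
    have h := tension_energy_le_low hL hε0 (by linarith) (by omega) hmin hBF hanti
    refine h.trans ?_
    have e : ∀ g : ℝ, g * (N : ℝ) ^ d * ((L : ℝ) ^ k) ^ d / ((L : ℝ) ^ k) ^ 6
        = g * ((N : ℝ) ^ d * ((L : ℝ) ^ k) ^ d / ((L : ℝ) ^ k) ^ 6) := fun g => by ring
    rw [e, e]
    exact mul_le_mul_of_nonneg_right (by linarith) hsc
  · -- the interior levels `k = j + 2`
    obtain ⟨j, rfl⟩ : ∃ j, k = j + 2 := ⟨k - 2, by omega⟩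
    obtain ⟨a, ha0, haε, hUa⟩ := hint V hV j U hmin
    haveI : NeZero N := ⟨by omega⟩
    haveI : NeZero (L ^ (j + 2) * N) := ⟨(mul_pos (pow_pos (by omega) _) (by omega)).ne'⟩
    have hx1 : ε / ((L : ℝ) ^ (j + 2)) ^ 2 ≤ ε :=
      div_le_self hε0 (one_le_pow₀ (one_le_pow₀ (by exact_mod_cast hL)))
    have ha4 : a ≤ 1 / 4 := by linarith
    have h := tension_energy_le_gprime hL2 hN j hmin ha0 ha4 haε hUa (hls j) (hKS j) (hsmall j) hBF hanti
    rw [Nat.mul_comm N]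
    refine h.trans ?_
    have e : ∀ g : ℝ, g * (N : ℝ) ^ d * ((L : ℝ) ^ (j + 2)) ^ d / ((L : ℝ) ^ (j + 2)) ^ 6
        = g * ((N : ℝ) ^ d * ((L : ℝ) ^ (j + 2)) ^ d / ((L : ℝ) ^ (j + 2)) ^ 6) := fun g => by ring
    rw [e, e]
    exact mul_le_mul_of_nonneg_right (by linarith) hsc

end

end Summit.QuantumFields.BalabanUV.T4Continuum.NE7TensionEnergyDocked
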